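import Mathlib.CategoryTheory.Limits.FullSubcategory
import Literature.AnabelianGeometry.Anabelioids.ProSigmaProofs
import Literature.AnabelianGeometry.Anabelioids.GaloisFullSubcategory
import Literature.AnabelianGeometry.Anabelioids.GaloisFiniteColimits
import Literature.AnabelianGeometry.Anabelioids.ExactFunctorProofs

/-!
# The quotient anabelioid `B(Π/N) ⊆ X` of a connected anabelioid by an open normal subgroup

[SGA1, Exp. V §5 (Galois correspondence, 5.8–5.11)] / Mochizuki, *Semi-graphs of anabelioids*,
Publ. RIMS **42** (2006), Def. 2.3 (i)–(iii) and Example 2.8 p. 31 [cite: MochizukiSemiAnbd2006,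
Ex. 2.8 p.31]: approximators `𝒢 → 𝒢'` "of bounded order" are obtained by passing, on each vertex
anabelioid `𝒢_v = B(Π_v)`, to a quotient `B(Π_v/N)` by an open normal subgroup `N ⊆ Π_v` (Ex. 2.8:
"every semi-graph of anabelioids `𝒢` such that `𝒢_e` is trivial for all edges `e` is
quasi-coherent").  For a connected anabelioid `X` with basepoint `F` (so `Π = Aut F`) and a
subgroup `N ≤ Aut F`, the quotient `B(Π/N)` is, inside `X`, the full subcategory of objects on
whose fibre `N` acts trivially.

* `fixedObj F N` / `Fixed F N` — that object property / full subcategory;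
* it is stable under finite limits, finite colimits and subobjects (`fixedObj_of_mono`,
  `isClosedUnderLimitsOfShape_fixedObj`, `isClosedUnderColimitsOfShape_fixedObj`, …), hence a
  connected anabelioid (`galoisCategory_fixed`, via `galoisCategory_fullSubcategory`) whose inclusion
  `ι` is exact (`preservesFiniteLimits_fixedι`, `preservesFiniteColimits_fixedι`);
* `Hom.toFixed F N : X → B(Π/N)` — the quotient morphism of anabelioids (pull-back functor `ι`).

That `π₁(B(Π/N)) = Π/N` (for `N` open normal) is proved in `QuotientAnabelioidProofs.lean`.
-/

namespace Literature.AnabelianGeometry.Anabelioids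

open CategoryTheory CategoryTheory.Limits CategoryTheory.PreGaloisCategory

universe w v₁ u₁

section Def

variable {X : Type u₁} [Category.{v₁} X] (F : X ⥤ FintypeCat.{w})

/-- The objects of the *quotient anabelioid* `B(Π/N) ⊆ X` (`Π = Aut F`): those on whose fibre the
subgroup `N ≤ Aut F` acts trivially ([SGA1] V §5; the approximator construction of [SemiAnbd]
Def. 2.3 / Ex. 2.8). [cite: MochizukiSemiAnbd2006, Ex. 2.8 p.31] -/
def fixedObj (N : Subgroup (Aut F)) : ObjectProperty X := fun A => ∀ σ ∈ N, σ.hom.app A = 𝟙 _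

/-- The *quotient anabelioid* `B(Π/N)` of `X` by `N ≤ Π = Aut F`, as a full subcategory of `X`.
[cite: MochizukiSemiAnbd2006, Ex. 2.8 p.31] -/
abbrev Fixed (N : Subgroup (Aut F)) := (fixedObj F N).FullSubcategory

/-- Unfolding `fixedObj`. [cite: MochizukiSemiAnbd2006, Ex. 2.8 p.31] -/
theorem fixedObj_iff (N : Subgroup (Aut F)) (A : X) :
    fixedObj F N A ↔ ∀ σ ∈ N, σ.hom.app A = 𝟙 _ := Iff.rfl

/-- `B(Π/N') ⊆ B(Π/N)` for `N ≤ N'`. [cite: MochizukiSemiAnbd2006, Ex. 2.8 p.31] -/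
theorem fixedObj_anti {N N' : Subgroup (Aut F)} (h : N ≤ N') {A : X} (hA : fixedObj F N' A) :
    fixedObj F N A := fun σ hσ => hA σ (h hσ)

/-- Every object lies in `B(Π/1) = X`. [cite: MochizukiSemiAnbd2006, Ex. 2.8 p.31] -/
theorem fixedObj_bot (A : X) : fixedObj F ⊥ A := fun σ hσ => by
  rw [Subgroup.mem_bot] at hσ
  subst hσ
  rfl

end Def

section Closure

variable {X : Type u₁} [Category.{v₁} X] [GaloisCategory X] (F : X ⥤ FintypeCat.{w})
  [FiberFunctor F] (N : Subgroup (Aut F))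

/-- `B(Π/N)` is stable under subobjects. [cite: MochizukiSemiAnbd2006, Ex. 2.8 p.31] -/
theorem fixedObj_of_mono {A B : X} (i : A ⟶ B) [Mono i] (hB : fixedObj F N B) :
    fixedObj F N A := fun σ hσ =>
  app_eq_id_of_injective F i (ConcreteCategory.injective_of_mono_of_preservesPullback (F.map i))
    σ (hB σ hσ)

/-- `B(Π/N)` is stable under quotients. [cite: MochizukiSemiAnbd2006, Ex. 2.8 p.31] -/
theorem fixedObj_of_epi {A B : X} (p : A ⟶ B) [Epi p] (hA : fixedObj F N A) :
    fixedObj F N B := fun σ hσ =>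
  app_eq_id_of_surjective F p (surjective_on_fiber_of_epi F p) σ (hA σ hσ)

/-- `B(Π/N)` is stable under finite limits. [cite: MochizukiSemiAnbd2006, Ex. 2.8 p.31] -/
instance isClosedUnderLimitsOfShape_fixedObj (J : Type) [SmallCategory J] [FinCategory J] :
    (fixedObj F N).IsClosedUnderLimitsOfShape J where
  limitsOfShape_le := by
    rintro A ⟨p⟩
    exact fun σ hσ => app_eq_id_of_isLimit F _ p.isLimit σ fun j => p.prop_diag_obj j σ hσ

/-- `B(Π/N)` is stable under finite coproducts. [cite: MochizukiSemiAnbd2006, Ex. 2.8 p.31] -/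
instance isClosedUnderColimitsOfShape_fixedObj_discrete (J : Type) [Finite J] :
    (fixedObj F N).IsClosedUnderColimitsOfShape (Discrete J) where
  colimitsOfShape_le := by
    rintro A ⟨p⟩
    exact fun σ hσ => app_eq_id_of_isColimit F _ p.isColimit σ fun j => p.prop_diag_obj j σ hσ

/-- `B(Π/N)` is stable under quotients by group actions. [cite: MochizukiSemiAnbd2006, Ex. 2.8 p.31] -/
instance isClosedUnderColimitsOfShape_fixedObj_singleObj (G : Type*) [Monoid G] :
    (fixedObj F N).IsClosedUnderColimitsOfShape (SingleObj G) where
  colimitsOfShape_le := by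
    rintro A ⟨p⟩
    exact fun σ hσ => app_eq_id_of_isColimit_singleObj F _ p.isColimit σ (p.prop_diag_obj _ σ hσ)

/-- `B(Π/N)` is stable under all finite colimits (a finite colimit is a quotient of the finite
coproduct). [cite: MochizukiSemiAnbd2006, Ex. 2.8 p.31] -/
instance isClosedUnderColimitsOfShape_fixedObj (J : Type) [SmallCategory J] [FinCategory J] :
    (fixedObj F N).IsClosedUnderColimitsOfShape J where
  colimitsOfShape_le := by
    rintro A ⟨p⟩
    have hcop : fixedObj F N (∐ p.diag.obj) :=
      (fixedObj F N).prop_colimit (Discrete.functor p.diag.obj) fun ⟨j⟩ => p.prop_diag_obj j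
    let e : ∐ p.diag.obj ⟶ A := Sigma.desc fun j => p.ι.app j
    haveI : Epi e := ⟨fun u v huv => p.isColimit.hom_ext fun j => by
      have h := congrArg (Sigma.ι p.diag.obj j ≫ ·) huv
      simp only [e, Sigma.ι_desc_assoc] at h
      exact h⟩
    exact fixedObj_of_epi F N e hcop

/-- **`B(Π/N)` is a connected anabelioid** (a Galois category), for any subgroup `N ≤ Π`.
[cite: MochizukiSemiAnbd2006, Ex. 2.8 p.31] -/
instance galoisCategory_fixed : GaloisCategory (Fixed F N) :=
  galoisCategory_fullSubcategory (P := fixedObj F N) (fun _ _ => inferInstance)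
    (fun _ _ _ => inferInstance) fun _ _ i _ hB => fixedObj_of_mono F N i hB

/-- The inclusion `ι : B(Π/N) ⥤ X` preserves finite limits. [cite: MochizukiSemiAnbd2006, Ex. 2.8 p.31] -/
instance preservesFiniteLimits_fixedι : PreservesFiniteLimits (fixedObj F N).ι :=
  ⟨fun _ _ _ => inferInstance⟩

/-- The inclusion `ι : B(Π/N) ⥤ X` preserves finite colimits. [cite: MochizukiSemiAnbd2006, Ex. 2.8 p.31] -/
instance preservesFiniteColimits_fixedι : PreservesFiniteColimits (fixedObj F N).ι := by
  refine ⟨fun J _ _ => ?_⟩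
  haveI : HasColimitsOfShape J X := hasColimitsOfShape_of_galoisCategory X J
  infer_instance

/-- **The quotient morphism of anabelioids `X → B(Π/N)`**: its pull-back functor is the (exact)
inclusion `ι`. [cite: MochizukiSemiAnbd2006, Ex. 2.8 p.31] -/
noncomputable def Hom.toFixed : Hom X (Fixed F N) := ExactFunctor.of (fixedObj F N).ι

/-- The pull-back functor of `X → B(Π/N)` is the inclusion. [cite: MochizukiSemiAnbd2006, Ex. 2.8 p.31] -/
@[simp] theorem Hom.toFixed_pullback : (Hom.toFixed F N).pullback = (fixedObj F N).ι := rfl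

/-- The restriction `ι ⋙ F'` of any basepoint `F'` of `X` is a basepoint of `B(Π/N)`.
[cite: MochizukiSemiAnbd2006, Ex. 2.8 p.31] -/
instance fiberFunctor_fixedι_comp (F' : X ⥤ FintypeCat.{w}) [FiberFunctor F'] :
    FiberFunctor ((fixedObj F N).ι ⋙ F') :=
  fiberFunctor_comp_of_exact _ _

end Closure

end Literature.AnabelianGeometry.Anabelioids
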